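import Literature.Computability.Complexity.CodeFPRat
import Literature.Computability.Complexity.CodeFPArith
import Literature.Computability.Cryptography.QuantumTuringMachine
import Mathlib.Analysis.SpecialFunctions.Complex.Arctan
import Mathlib.Analysis.SpecialFunctions.Trigonometric.Arctan
import Mathlib.Analysis.SpecificLimits.Normed
import HarnessLib

/-!
# `π` to any dyadic precision in polynomial time: Machin's formula with the arctangent series

Topic `Computability/Complexity`, toolkit above the typed polynomial-time algebra `CodeFP`
(`CodeFP.lean`, `CodeFPArith.lean`, `CodeFPRat.lean`: exact rational arithmetic, `ratSum`, `natPow`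
with unary exponents). The finite-precision machines of the lattice/`LWE` trunk evaluate Gaussian
weights `e^{-π‖x‖²/s²}`, their integrals and the phases `e^{2πi m/2ʲ}` of the quantum Fourier transform
(Regev 2009, §3.2.2 with §2 p. 11: "a model that approximates real numbers up to an error of
`2^{-nᶜ}`"); all of them need the constant `π` to `p` bits for a `p` that grows polynomially. This
file provides it by the textbook route (Machin 1706; Knuth, TAOCP 2, §4.1 ex. 4.1-14 / Borwein–Borwein,
*Pi and the AGM*, §11.1: `π/4 = 4 arctan(1/5) − arctan(1/239)` with the alternating Gregory series
`arctan x = Σ (−1)ᵏ x^{2k+1}/(2k+1)`, whose truncation error is at most the first omitted term):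

* `MachinPi.arctanInvSum m K = Σ_{k<K} (−1)ᵏ/((2k+1) m^{2k+1}) ∈ ℚ` and
  **`MachinPi.abs_arctan_inv_sub_arctanInvSum_le`**: `|arctan(1/m) − arctanInvSum m K| ≤ 1/((2K+1) m^{2K+1})`
  for `m ≥ 2` (Mathlib's `Real.hasSum_arctan` and `alternating_series_error_bound`);
* `MachinPi.piSum K = 16·arctanInvSum 5 K − 4·arctanInvSum 239 K` with
  **`MachinPi.abs_pi_sub_piSum_le`**: `|π − piSum K| ≤ 4/25ᴷ` (Mathlib's Machin identity
  `Real.four_mul_arctan_inv_5_sub_arctan_inv_239`); `MachinPi.piApprox p = piSum (p+1)`,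
  **`abs_pi_sub_piApprox_le`**: `|π − piApprox p| ≤ 2⁻ᵖ/2`; the dyadic name
  `MachinPi.piDyadic p = round(2ᵖ · piApprox p) ∈ ℤ`, **`abs_pi_sub_piDyadic_div_le`**:
  `|π − piDyadic p / 2ᵖ| ≤ 2⁻ᵖ`;
* **polynomial time** in the unary precision: `CodeFP.ratRound` (`q ↦ round q`, the brick
  `Brick.qroundF` typed), `MachinPi.codeFP_arctanInvSum`, `codeFP_piSum`, `codeFP_piApprox`
  (`1ᵖ ↦ encodeRat (piApprox p)`), `codeFP_piDyadic` (`1ᵖ ↦ intE (piDyadic p)`), assembled from the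
  `CodeFP` combinators (a bounded `map` of the terms over `[0, K)`, each term a lowest-terms fraction of a
  sign and `(2k+1)·m^{2k+1}` by `natPow`, then the exact sum `ratSum`) — no machine is written;
* **`MachinPi.isPolyTimeComputableReal_pi`** — hence `π` is a polynomial-time computable real in the
  sense of Ko 1991 / Bernstein–Vazirani 1997 (`Cryptography.IsPolyTimeComputableReal`,
  `Cryptography/QuantumTuringMachine.lean`), with the name `piDyadic`.

Everything here is proved; definitions have bodies; no named fact is introduced.

## References

* J. M. Borwein, P. B. Borwein, *Pi and the AGM*, Wiley 1987, §11.1 (Machin's formula and the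
  Gregory series; error of the alternating series) [BorweinBorwein1987].
* D. E. Knuth, *The Art of Computer Programming*, Vol. 2, 3rd ed., Addison-Wesley 1998, §4.3.1
  (multiple-precision arithmetic) [KnuthTAOCP2].
* K.-I. Ko, *Complexity Theory of Real Functions*, Birkhäuser 1991, Def. 2.1 (polynomial-time
  computable reals) [Ko1991].
* O. Regev, *On lattices, learning with errors, random linear codes, and cryptography*, J. ACM 56
  (2009), art. 34, §2 (p. 11: approximating real numbers to within `2^{-nᶜ}`) [Regev2009].
-/

noncomputable section

namespace Literature.Computability.Complexity

open _root_.Computability Finset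
open Literature.Algebra.EuclideanLattices (encodeRat)

/-! ### Rounding a rational code to an integer code -/

namespace CodeFP

open Brick

/-- **Rounding to the nearest integer on codes**: `encodeRat q ↦ intE (round q)` (the brick
`Brick.qroundF` on the lowest-terms numerator/denominator pair). [cite: KnuthTAOCP2, §4.5.1] -/
theorem ratRound : CodeFP encodeRat intE (fun q : ℚ => round q) := by
  obtain ⟨f, hf, hfs⟩ := ratNumDen
  refine ⟨qroundF ∘ f, comp_mem_FP qroundF_mem_FP hf, fun q => ?_⟩
  rw [Function.comp_apply, hfs, pairE_apply, qroundF_dpEnc _ q.den_pos, Rat.num_div_den]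

end CodeFP

namespace MachinPi

/-! ### The Gregory series of `arctan (1/m)` and its truncation error -/

/-- The `k`-th term of the Gregory series of `arctan x` without its sign: `x^{2k+1}/(2k+1)`. [cite: BorweinBorwein1987, §11.1] -/
def gregoryTerm (x : ℝ) (k : ℕ) : ℝ := x ^ (2 * k + 1) / (2 * k + 1 : ℕ)

/-- The terms are nonnegative for `x ≥ 0`. [folklore] -/
theorem gregoryTerm_nonneg {x : ℝ} (hx : 0 ≤ x) (k : ℕ) : 0 ≤ gregoryTerm x k :=
  div_nonneg (pow_nonneg hx _) (Nat.cast_nonneg _)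

/-- The terms decrease for `0 ≤ x ≤ 1`. [cite: BorweinBorwein1987, §11.1] -/
theorem antitone_gregoryTerm {x : ℝ} (hx : 0 ≤ x) (hx1 : x ≤ 1) : Antitone (gregoryTerm x) := by
  refine antitone_nat_of_succ_le fun k => ?_
  unfold gregoryTerm
  have h1 : x ^ (2 * (k + 1) + 1) ≤ x ^ (2 * k + 1) := pow_le_pow_of_le_one hx hx1 (by omega)
  have h2 : (0 : ℝ) < (2 * k + 1 : ℕ) := by positivity
  have h3 : ((2 * k + 1 : ℕ) : ℝ) ≤ (2 * (k + 1) + 1 : ℕ) := by exact_mod_cast (by omega)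
  calc x ^ (2 * (k + 1) + 1) / ((2 * (k + 1) + 1 : ℕ) : ℝ)
      ≤ x ^ (2 * k + 1) / ((2 * (k + 1) + 1 : ℕ) : ℝ) := by gcongr
    _ ≤ x ^ (2 * k + 1) / ((2 * k + 1 : ℕ) : ℝ) := by gcongr

/-- The terms are dominated by a geometric sequence: `x^{2k+1}/(2k+1) ≤ xᵏ` for `0 ≤ x ≤ 1`. [folklore] -/
theorem gregoryTerm_le_pow {x : ℝ} (hx : 0 ≤ x) (hx1 : x ≤ 1) (k : ℕ) : gregoryTerm x k ≤ x ^ k := by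
  unfold gregoryTerm
  have h2 : (1 : ℝ) ≤ (2 * k + 1 : ℕ) := by exact_mod_cast (by omega)
  calc x ^ (2 * k + 1) / ((2 * k + 1 : ℕ) : ℝ) ≤ x ^ (2 * k + 1) / 1 := by
        gcongr
    _ = x ^ (2 * k + 1) := div_one _
    _ ≤ x ^ k := pow_le_pow_of_le_one hx hx1 (by omega)

/-- The terms are summable for `0 ≤ x < 1`. [folklore] -/
theorem summable_gregoryTerm {x : ℝ} (hx : 0 ≤ x) (hx1 : x < 1) : Summable (gregoryTerm x) :=
  Summable.of_nonneg_of_le (gregoryTerm_nonneg hx) (gregoryTerm_le_pow hx hx1.le)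
    (summable_geometric_of_lt_one hx hx1)

/-- **The Gregory series**: `arctan x = Σ (−1)ᵏ x^{2k+1}/(2k+1)` for `0 ≤ x < 1` (Mathlib's
`Real.hasSum_arctan`). [cite: BorweinBorwein1987, §11.1] -/
theorem hasSum_gregory {x : ℝ} (hx : 0 ≤ x) (hx1 : x < 1) :
    HasSum (fun k => (-1) ^ k * gregoryTerm x k) (Real.arctan x) := by
  have h := Real.hasSum_arctan (x := x) (by rwa [Real.norm_eq_abs, abs_of_nonneg hx])
  refine h.congr_fun fun k => ?_
  unfold gregoryTerm
  rw [mul_div_assoc]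

/-- **Truncation error of the Gregory series**: the first omitted term. [cite: BorweinBorwein1987, §11.1] -/
theorem abs_arctan_sub_sum_le {x : ℝ} (hx : 0 ≤ x) (hx1 : x < 1) (K : ℕ) :
    |Real.arctan x - ∑ k ∈ range K, (-1) ^ k * gregoryTerm x k| ≤ gregoryTerm x K := by
  have h := alternating_series_error_bound (gregoryTerm x) (antitone_gregoryTerm hx hx1.le)
    (summable_gregoryTerm hx hx1) K
  rwa [← (hasSum_gregory hx hx1).tsum_eq]

/-- The `k`-th term of the series of `arctan (1/m)` as an exact rational:
`(−1)ᵏ / ((2k+1) m^{2k+1})`. [cite: BorweinBorwein1987, §11.1] -/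
def termQ (m k : ℕ) : ℚ := (((-1 : ℤ) ^ k : ℤ) : ℚ) / (((2 * k + 1) * m ^ (2 * k + 1) : ℕ) : ℚ)

/-- **The truncated Gregory series of `arctan (1/m)`** with `K` terms, an exact rational. [cite: BorweinBorwein1987, §11.1] -/
def arctanInvSum (m K : ℕ) : ℚ := ((List.range K).map (termQ m)).sum

/-- The rational term cast to `ℝ` is the signed Gregory term at `x = 1/m`. [folklore] -/
theorem cast_termQ (m : ℕ) (hm : 0 < m) (k : ℕ) :
    ((termQ m k : ℚ) : ℝ) = (-1) ^ k * gregoryTerm ((m : ℝ)⁻¹) k := by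
  unfold termQ gregoryTerm
  have hm' : (m : ℝ) ≠ 0 := by exact_mod_cast hm.ne'
  have h2 : ((2 * k + 1 : ℕ) : ℝ) ≠ 0 := by positivity
  push_cast
  rw [inv_pow]
  field_simp

/-- The truncated series cast to `ℝ` is the alternating partial sum. [folklore] -/
theorem cast_arctanInvSum (m : ℕ) (hm : 0 < m) (K : ℕ) :
    ((arctanInvSum m K : ℚ) : ℝ) = ∑ k ∈ range K, (-1) ^ k * gregoryTerm ((m : ℝ)⁻¹) k := by
  unfold arctanInvSum
  induction K with
  | zero => simp
  | succ K ih =>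
    rw [List.range_succ, List.map_append, List.sum_append, List.map_singleton, List.sum_singleton,
      Rat.cast_add, ih, sum_range_succ, cast_termQ m hm]

/-- **`|arctan(1/m) − arctanInvSum m K| ≤ 1/((2K+1)·m^{2K+1})`** for `m ≥ 2`. [cite: BorweinBorwein1987, §11.1] -/
theorem abs_arctan_inv_sub_arctanInvSum_le {m : ℕ} (hm : 2 ≤ m) (K : ℕ) :
    |Real.arctan ((m : ℝ)⁻¹) - (arctanInvSum m K : ℝ)| ≤ 1 / ((2 * K + 1 : ℕ) * (m : ℝ) ^ (2 * K + 1)) := by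
  have hm0 : (0 : ℝ) < m := by exact_mod_cast (by omega)
  have hx : (0 : ℝ) ≤ (m : ℝ)⁻¹ := inv_nonneg.2 hm0.le
  have hx1 : (m : ℝ)⁻¹ < 1 := inv_lt_one_of_one_lt₀ (by exact_mod_cast (by omega))
  rw [cast_arctanInvSum m (by omega)]
  refine (abs_arctan_sub_sum_le hx hx1 K).trans (le_of_eq ?_)
  unfold gregoryTerm
  rw [inv_pow]
  field_simp

/-! ### Machin's formula -/

/-- **Machin's formula**: `π = 16 arctan(1/5) − 4 arctan(1/239)` (Mathlib). [cite: BorweinBorwein1987, §11.1] -/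
theorem pi_eq_machin : Real.pi = 16 * Real.arctan ((5 : ℝ)⁻¹) - 4 * Real.arctan ((239 : ℝ)⁻¹) := by
  have h := Real.four_mul_arctan_inv_5_sub_arctan_inv_239
  linarith

/-- **The Machin partial sum** with `K` terms in each arctangent series. [cite: BorweinBorwein1987, §11.1] -/
def piSum (K : ℕ) : ℚ := 16 * arctanInvSum 5 K + (-4) * arctanInvSum 239 K

/-- **`|π − piSum K| ≤ 4/25ᴷ`.** [cite: BorweinBorwein1987, §11.1] -/
theorem abs_pi_sub_piSum_le (K : ℕ) : |Real.pi - (piSum K : ℝ)| ≤ 4 / (25 : ℝ) ^ K := by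
  have h5 := abs_arctan_inv_sub_arctanInvSum_le (m := 5) (by norm_num) K
  have h239 := abs_arctan_inv_sub_arctanInvSum_le (m := 239) (by norm_num) K
  have e5 : ((5 : ℕ) : ℝ) = 5 := by norm_num
  have e239 : ((239 : ℕ) : ℝ) = 239 := by norm_num
  rw [e5] at h5
  rw [e239] at h239
  have hK : (1 : ℝ) ≤ (2 * K + 1 : ℕ) := by exact_mod_cast (by omega)
  have hp5 : (0 : ℝ) < (5 : ℝ) ^ (2 * K + 1) := by positivity
  have hp239 : (0 : ℝ) < (239 : ℝ) ^ (2 * K + 1) := by positivity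
  -- the two error terms are at most `1/5^{2K+1}` each
  have b5 : 1 / ((2 * K + 1 : ℕ) * (5 : ℝ) ^ (2 * K + 1)) ≤ 1 / (5 : ℝ) ^ (2 * K + 1) := by
    apply one_div_le_one_div_of_le hp5
    calc (5 : ℝ) ^ (2 * K + 1) = 1 * (5 : ℝ) ^ (2 * K + 1) := (one_mul _).symm
      _ ≤ (2 * K + 1 : ℕ) * (5 : ℝ) ^ (2 * K + 1) := by gcongr
  have b239 : 1 / ((2 * K + 1 : ℕ) * (239 : ℝ) ^ (2 * K + 1)) ≤ 1 / (5 : ℝ) ^ (2 * K + 1) := by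
    apply one_div_le_one_div_of_le hp5
    calc (5 : ℝ) ^ (2 * K + 1) ≤ (239 : ℝ) ^ (2 * K + 1) := by gcongr; norm_num
      _ = 1 * (239 : ℝ) ^ (2 * K + 1) := (one_mul _).symm
      _ ≤ (2 * K + 1 : ℕ) * (239 : ℝ) ^ (2 * K + 1) := by gcongr
  have hcast : (piSum K : ℝ) = 16 * (arctanInvSum 5 K : ℝ) + (-4) * (arctanInvSum 239 K : ℝ) := by
    unfold piSum; push_cast; ring
  rw [pi_eq_machin, hcast]
  have hsplit : 16 * Real.arctan ((5 : ℝ)⁻¹) - 4 * Real.arctan ((239 : ℝ)⁻¹) -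
      (16 * (arctanInvSum 5 K : ℝ) + (-4) * (arctanInvSum 239 K : ℝ)) =
      16 * (Real.arctan ((5 : ℝ)⁻¹) - arctanInvSum 5 K) - 4 * (Real.arctan ((239 : ℝ)⁻¹) - arctanInvSum 239 K) := by
    ring
  rw [hsplit]
  have hpow : (5 : ℝ) ^ (2 * K + 1) = 5 * (25 : ℝ) ^ K := by
    rw [pow_succ, pow_mul]; norm_num; ring
  calc |16 * (Real.arctan ((5 : ℝ)⁻¹) - arctanInvSum 5 K) - 4 * (Real.arctan ((239 : ℝ)⁻¹) - arctanInvSum 239 K)|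
      ≤ |16 * (Real.arctan ((5 : ℝ)⁻¹) - arctanInvSum 5 K)| + |4 * (Real.arctan ((239 : ℝ)⁻¹) - arctanInvSum 239 K)| :=
        abs_sub _ _
    _ = 16 * |Real.arctan ((5 : ℝ)⁻¹) - arctanInvSum 5 K| + 4 * |Real.arctan ((239 : ℝ)⁻¹) - arctanInvSum 239 K| := by
        rw [abs_mul, abs_mul]; norm_num
    _ ≤ 16 * (1 / (5 : ℝ) ^ (2 * K + 1)) + 4 * (1 / (5 : ℝ) ^ (2 * K + 1)) := by
        gcongr
        · exact h5.trans b5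
        · exact h239.trans b239
    _ = 4 / (25 : ℝ) ^ K := by
        rw [hpow]
        have : (0 : ℝ) < (25 : ℝ) ^ K := by positivity
        field_simp
        ring

/-- **The approximation at precision `p`**: `p + 1` terms of each series. [cite: BorweinBorwein1987, §11.1] -/
def piApprox (p : ℕ) : ℚ := piSum (p + 1)

/-- `4 · 2ᵖ · 2 ≤ 25^{p+1}`. [folklore] -/
theorem eight_mul_two_pow_le (p : ℕ) : (8 : ℝ) * 2 ^ p ≤ 25 ^ (p + 1) := by
  have h : (2 : ℝ) ^ p ≤ 25 ^ p := by gcongr; norm_num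
  rw [pow_succ]
  nlinarith [pow_pos (show (0 : ℝ) < 25 by norm_num) p]

/-- **`|π − piApprox p| ≤ 2⁻ᵖ/2`.** [cite: BorweinBorwein1987, §11.1] -/
theorem abs_pi_sub_piApprox_le (p : ℕ) : |Real.pi - (piApprox p : ℝ)| ≤ 1 / (2 * (2 : ℝ) ^ p) := by
  refine (abs_pi_sub_piSum_le (p + 1)).trans ?_
  rw [div_le_div_iff₀ (by positivity) (by positivity)]
  have := eight_mul_two_pow_le p
  linarith

/-- **The dyadic name of `π`**: `piDyadic p = round (2ᵖ · piApprox p)`. [cite: Ko1991, Def. 2.1] -/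
def piDyadic (p : ℕ) : ℤ := round ((((2 : ℕ) ^ p : ℕ) : ℤ) / ((1 : ℕ) : ℚ) * piApprox p)

/-- Unfolding: `piDyadic p = round (2ᵖ · piApprox p)`. [folklore] -/
theorem piDyadic_eq (p : ℕ) : piDyadic p = round ((2 : ℚ) ^ p * piApprox p) := by
  unfold piDyadic
  congr 1
  push_cast
  ring

/-- **`|π − piDyadic p / 2ᵖ| ≤ 2⁻ᵖ`**: a `2⁻ᵖ`-accurate dyadic approximation. [cite: Ko1991, Def. 2.1] -/
theorem abs_pi_sub_piDyadic_div_le (p : ℕ) : |Real.pi - (piDyadic p : ℝ) / (2 : ℝ) ^ p| ≤ 1 / (2 : ℝ) ^ p := by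
  have h2 : (0 : ℝ) < (2 : ℝ) ^ p := by positivity
  have happ := abs_pi_sub_piApprox_le p
  set q : ℚ := piApprox p with hq
  have hround : |((2 : ℚ) ^ p * q : ℚ) - (round ((2 : ℚ) ^ p * q) : ℚ)| ≤ 1 / 2 := abs_sub_round _
  have hroundR : |(2 : ℝ) ^ p * (q : ℝ) - (round ((2 : ℚ) ^ p * q) : ℝ)| ≤ 1 / 2 := by
    have := (Rat.cast_le (K := ℝ)).2 hround
    push_cast at this
    exact this
  rw [piDyadic_eq]
  have hsplit : Real.pi - ((round ((2 : ℚ) ^ p * q) : ℤ) : ℝ) / (2 : ℝ) ^ p =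
      (Real.pi - (q : ℝ)) + ((2 : ℝ) ^ p * (q : ℝ) - ((round ((2 : ℚ) ^ p * q) : ℤ) : ℝ)) / (2 : ℝ) ^ p := by
    field_simp
    ring
  rw [hsplit]
  calc |Real.pi - (q : ℝ) + ((2 : ℝ) ^ p * (q : ℝ) - ((round ((2 : ℚ) ^ p * q) : ℤ) : ℝ)) / (2 : ℝ) ^ p|
      ≤ |Real.pi - (q : ℝ)| + |((2 : ℝ) ^ p * (q : ℝ) - ((round ((2 : ℚ) ^ p * q) : ℤ) : ℝ)) / (2 : ℝ) ^ p| :=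
        abs_add_le _ _
    _ ≤ 1 / (2 * (2 : ℝ) ^ p) + (1 / 2) / (2 : ℝ) ^ p := by
        gcongr
        rw [abs_div, abs_of_pos h2]
        gcongr
    _ = 1 / (2 : ℝ) ^ p := by
        field_simp
        ring

/-- The bound in the `(1/2)ᵖ` form of `Cryptography.IsPolyTimeComputableReal`. [cite: Ko1991, Def. 2.1] -/
theorem abs_pi_sub_piDyadic_le_half_pow (p : ℕ) : |Real.pi - (piDyadic p : ℝ) / (2 : ℝ) ^ p| ≤ (1 / 2 : ℝ) ^ p := by
  rw [one_div_pow]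
  exact abs_pi_sub_piDyadic_div_le p

/-! ### Polynomial time in the unary precision -/

open CodeFP

/-- `(−1)ᵏ` from the parity of `k`. [folklore] -/
theorem neg_one_pow_eq_ite (k : ℕ) : ((-1 : ℤ) ^ k) = if decide (k % 2 = 0) then 1 else -1 := by
  rcases Nat.even_or_odd k with h | h
  · rw [h.neg_one_pow, if_pos (by rw [decide_eq_true_eq]; exact Nat.even_iff.1 h)]
  · rw [h.neg_one_pow, if_neg (by rw [decide_eq_true_eq]; rw [Nat.odd_iff] at h; omega)]

/-- **The term map is polynomial time**, in the form `(1ᴮ, bin k) ↦ termQ m k` computed with the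
exponent capped at the unary budget `B` (no cap takes effect when `2k + 1 ≤ B`). [cite: KnuthTAOCP2, §4.3.1] -/
theorem codeFP_termCapped (m : ℕ) :
    CodeFP (pairE unE natE) encodeRat
      (fun p => (((-1 : ℤ) ^ p.2 : ℤ) : ℚ) / (((2 * p.2 + 1) * m ^ (min (2 * p.2 + 1) p.1) : ℕ) : ℚ)) := by
  have hk : CodeFP (pairE unE natE) natE (fun p => p.2) := snd _ _
  have hB : CodeFP (pairE unE natE) unE (fun p => p.1) := fst _ _
  have he : CodeFP (pairE unE natE) natE (fun p => 2 * p.2 + 1) :=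
    (natAdd.comp ((natMul.comp ((const _ 2).pair hk)).pair (const _ 1)) :)
  have heu : CodeFP (pairE unE natE) unE (fun p => min (2 * p.2 + 1) p.1) := (unOfNatMin.comp (hB.pair he) :)
  have hpow : CodeFP (pairE unE natE) natE (fun p => m ^ (min (2 * p.2 + 1) p.1)) :=
    (natPow.comp ((const _ m).pair heu) :)
  have hden : CodeFP (pairE unE natE) natE (fun p => (2 * p.2 + 1) * m ^ (min (2 * p.2 + 1) p.1)) :=
    (natMul.comp (he.pair hpow) :)
  have hpar : CodeFP (pairE unE natE) bitE (fun p => decide (p.2 % 2 = 0)) :=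
    (natEq.comp ((natMod.comp (hk.pair (const _ 2))).pair (const _ 0)) :)
  have hsign : CodeFP (pairE unE natE) intE (fun p => ((-1 : ℤ) ^ p.2 : ℤ)) :=
    (hpar.ite (const _ (1 : ℤ)) (const _ (-1 : ℤ))).congr fun p => by rw [neg_one_pow_eq_ite]
  exact (ratOfIntNat.comp (hsign.pair hden)).congr fun _ => rfl

/-- **`1ᴷ ↦ arctanInvSum m K` is polynomial time.** [cite: KnuthTAOCP2, §4.3.1] -/
theorem codeFP_arctanInvSum (m : ℕ) : CodeFP unE encodeRat (arctanInvSum m) := by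
  -- budget `B = 2K + 1`, items `[0, K)`
  have hBud : CodeFP unE unE (fun K => 2 * K + 1) := (unSucc.comp (unAdd.comp ((CodeFP.id unE).pair (CodeFP.id unE)))).congr
    fun K => by simp; ring
  have hmap := (map (codeFP_termCapped m)).comp (hBud.pair urange)
  refine ((ratSum.comp hmap).congr fun K => ?_)
  unfold arctanInvSum
  congr 1
  refine List.map_congr_left fun k hk => ?_
  rw [List.mem_range] at hk
  unfold termQ
  rw [min_eq_left (by omega)]

/-- **`1ᴷ ↦ piSum K` is polynomial time.** [cite: KnuthTAOCP2, §4.3.1] -/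
theorem codeFP_piSum : CodeFP unE encodeRat piSum :=
  (ratAdd.comp ((ratMul.comp ((const _ (16 : ℚ)).pair (codeFP_arctanInvSum 5))).pair
    (ratMul.comp ((const _ (-4 : ℚ)).pair (codeFP_arctanInvSum 239))))).congr fun _ => rfl

/-- **`1ᵖ ↦ piApprox p` is polynomial time.** [cite: KnuthTAOCP2, §4.3.1] -/
theorem codeFP_piApprox : CodeFP unE encodeRat piApprox :=
  (codeFP_piSum.comp unSucc).congr fun _ => rfl

/-- **`1ᵖ ↦ piDyadic p` is polynomial time** (in the difference-pair integer code `intE`). [cite: Ko1991, Def. 2.1] -/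
theorem codeFP_piDyadic : CodeFP unE intE piDyadic := by
  have h2p : CodeFP unE encodeRat (fun p => ((((2 : ℕ) ^ p : ℕ) : ℤ) : ℚ) / ((1 : ℕ) : ℚ)) :=
    (ratOfIntNat.comp ((intOfNat.comp (natPow.comp ((const _ 2).pair (CodeFP.id unE)))).pair (const _ 1)) :)
  exact (ratRound.comp (ratMul.comp (h2p.pair codeFP_piApprox))).congr fun _ => rfl

/-- `1ᵖ ↦ piDyadic p` in the sign–magnitude integer code of `encodingIntBool`. [cite: Ko1991, Def. 2.1] -/
theorem codeFP_piDyadic_sm : CodeFP unE smE piDyadic := (smOfInt.comp codeFP_piDyadic :)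

/-- **`π` is a polynomial-time computable real** (Ko 1991, Def. 2.1; Bernstein–Vazirani 1997, §6),
with the name `piDyadic`: computable in polynomial time from `1ᵖ` and `2⁻ᵖ`-accurate.
[cite: Ko1991, Def. 2.1] [cite: BorweinBorwein1987, §11.1] -/
theorem isPolyTimeComputableReal_pi : Cryptography.IsPolyTimeComputableReal Real.pi :=
  ⟨piDyadic, codeFP_piDyadic_sm.polyTimeComputable, abs_pi_sub_piDyadic_le_half_pow⟩

end MachinPi

end Literature.Computability.Complexity

end
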